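import Mathlib.Analysis.SpecialFunctions.Complex.Log
import Literature.NumberTheory.Transcendental.RankOneGridTrdeg
import Literature.NumberTheory.Transcendental.PrasadRapinchukLemma72
import HarnessLib

/-!
# Prasad–Rapinchuk: fields generated by lengths of closed geodesics, and the exact use of Schanuel

G. Prasad, A. S. Rapinchuk, *On the fields generated by the lengths of closed geodesics in locally
symmetric spaces*, Geom. Dedicata **172** (2014) 79–120 = arXiv:1110.0141 [PrasadRapinchuk2013],
§7; and *Weakly commensurable arithmetic groups and isospectral locally symmetric spaces*, Publ.
Math. IHÉS **109** (2009) 113–184 = arXiv:0705.2891 [PrasadRapinchuk2009], §8.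

This file is the record, for the consumer route `Schanuel/GeodesicLengthsGP3`, of **where exactly
Schanuel's conjecture (SC) enters** these papers, with the transcendence-theoretic steps PROVED in
Lean and the differential-geometric layer recorded informally (it is not expressible over Mathlib
today: there are no Riemannian symmetric spaces `𝔛 = 𝒦\G(ℝ)` of real semisimple groups, no
locally symmetric quotients `𝔛_Γ`, no closed geodesics or their lengths, and no maximal `ℝ`-tori /
roots / characters of real algebraic groups evaluated at `γ`). Nothing is asserted without proof.

## The geometric dictionary (informal, as printed)

* **Length formula** [PrasadRapinchuk2009, Prop. 8.5 (arXiv: Prop. 8.2 and (E:G-1))],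
  restated as [PrasadRapinchuk2013, §7, first display (E:LG-1)]: `G` an absolutely simple adjoint
  algebraic `ℝ`-group with `𝒢 = G(ℝ)` noncompact, `𝔛 = 𝒦\𝒢` the symmetric space (Killing metric),
  `Γ ⊂ 𝒢` discrete torsion-free, `𝔛_Γ = 𝔛/Γ`. Every nontrivial semisimple `γ ∈ Γ` gives a closed
  geodesic `c_γ` of `𝔛_Γ`, every closed geodesic arises this way, and
  `ℓ(c_γ) = λ_Γ(γ)/n_γ` with an integer `n_γ ≥ 1` and
  `λ_Γ(γ)² = Σ_α (log |α(γ)|)²`, the sum over all roots `α` of `G` with respect to an arbitrary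
  maximal `ℝ`-torus `T ∋ γ`. Hence `ℚ·L(𝔛_Γ) = ℚ·{λ_Γ(γ) : γ ∈ Γ nontrivial semisimple}` and the
  field `ℱ` generated by the length set `L(𝔛_Γ)` is generated by the `λ_Γ(γ)`.
* **Positive-character form** [PrasadRapinchuk2009, §8 (E:G-2), remark after Prop. 8.5],
  [PrasadRapinchuk2013, (E:LG-2)]: `λ_Γ(γ)² = Σ_{k=1}^p s_k (log χ_k(γ))²` with `χ_k` positive
  characters of `T` (`χ_k(γ) > 0`) and `s_k` positive rationals (denominators dividing `4`).
  Choosing a `ℚ`-basis `a_γ = (a_{γ,1}, …, a_{γ,d_γ})`, `d_γ ≥ 1`, of the `ℚ`-span of the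
  `log χ_k(γ)`, each `a_{γ,i}` itself the logarithm of the value of a positive character at `γ`,
  one gets `λ_Γ(γ)² = q_γ(a_γ)` for a **nonzero rational quadratic form** `q_γ`
  (`λ_Γ(γ) > 0` for `γ ≠ 1` because `Γ` is torsion-free) [PrasadRapinchuk2013, proof of Prop. 7.1].
* **Proposition 7.1** [PrasadRapinchuk2013]: `𝒦 ⊂ ℝ` a subfield of finite transcendence degree
  `d` over `ℚ`; `G₁, G₂` semisimple `𝒦`-groups; `Γᵢ ⊂ Gᵢ(𝒦) ⊂ Gᵢ(ℝ)` discrete Zariski-dense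
  torsion-free; `ℱᵢ` the subfield of `ℝ` generated by the `λ_{Γᵢ}(γ)`, `γ ∈ Γᵢ` nontrivial
  semisimple. If nontrivial semisimple `γ₁, …, γ_m ∈ Γ₁` are multiplicatively independent and not
  weakly contained in `Γ₂`, then `tr.deg_{ℱ₂} ℱ₂(λ_{Γ₁}(γ₁), …, λ_{Γ₁}(γ_m)) ≥ m - d`.
  Corollary 7.3 then gives condition `(Tᵢ)`, and Theorems 1–4 follow; the Introduction states: "the
  proof of Proposition 7.1 assumes the truth of Schanuel's conjecture, and in fact it is the only
  place in the paper where the latter is used" (arXiv text p. 5), and §7 opens with "The results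
  of this section depend on the truth of Schanuel's conjecture".
* **How the hypotheses translate** (proof of Prop. 7.1, p. 24 of the arXiv text): with
  `A = ⋃ⱼ A_{γⱼ}` (`A_{γⱼ}` the entries of `a_{γⱼ}`) and `B` a maximal `ℚ`-linearly independent
  subset of `⋃ₖ A_{γₖ⁽²⁾}` for a finite set `Θ₂ ⊂ Γ₂`: "multiplicatively independent" ⟹ `A` is
  `ℚ`-linearly independent; "not weakly contained in `Γ₂`" ⟹ `A ∪ B` is `ℚ`-linearly independent;
  `ℚ(B) = 𝒫_{Θ₂} := ℚ(⋃_{γ ∈ Θ₂} A_γ)`; every finitely generated subfield of the field `ℳ₂`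
  generated by the `λ_{Γ₂}(γ)²` lies in some `𝒫_{Θ₂}`, and `ℱ₂` is algebraic over `ℳ₂` — which
  reduces Prop. 7.1 to the display (E:TD-1): `tr.deg_{𝒫_{Θ₂}} 𝒫_{Θ₂}(λ(γ₁), …, λ(γ_m)) ≥ m - d`.

## The exact use of SC, and what is proved here

The proof of Prop. 7.1 uses SC in ONE sentence: "by Schanuel's conjecture, the transcendence
degree over `ℚ` of the field generated by `A ∪ B ∪ Ã ∪ B̃` (`Ã = {eˢ : s ∈ A}`, …) is
`≥ α + β`. But `Ã ∪ B̃ ⊂ 𝒦̄` …, so the transcendence degree of the field generated by `A ∪ B` is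
`≥ α + β - d`." We prove, with `SchanuelRank` (the Literature rendering of SC, rank by rank) and
`Literature.Barriers.Schanuel.AlgIndepLogarithms` (Waldschmidt's Conjecture 1.1):

* `le_trdeg_adjoin_add_of_schanuel` — **the Schanuel step**: SC ⟹ for `ℚ`-linearly independent
  `z₁, …, zₙ ∈ ℂ` with `tr.deg_ℚ ℚ(e^{z₁}, …, e^{zₙ}) ≤ d`, `n ≤ tr.deg_ℚ ℚ(z₁, …, zₙ) + d`;
* `trdeg_adjoin_le_of_isAlgebraic` + `le_trdeg_adjoin_add_of_schanuel_of_isAlgebraic` — the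
  printed form: the `e^{zᵢ}` algebraic over a field `𝒦` with `tr.deg_ℚ 𝒦 ≤ d` ("`Ã ∪ B̃ ⊂ 𝒦̄`");
* `algebraicIndependent_sumElim_of_algIndepLogarithms`,
  `algebraicIndependent_over_adjoin_of_algIndepLogarithms` — the **arithmetic case `d = 0`**
  (`Γᵢ` arithmetic, character values algebraic): there SC is used exactly as `AlgIndepLogarithms`,
  giving `A` algebraically independent over `ℚ(B)`;
* `algebraicIndependent_aeval_fibre_of_algIndepLogarithms` — **the transcendence core of
  Prop. 7.1 for `d = 0`**: under `AlgIndepLogarithms`, if `a` (blocks `A_{γⱼ}` = fibres of `c`) and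
  `b` are logarithms of algebraic numbers with `a ⊕ b` `ℚ`-linearly independent, and
  `fⱼ = pⱼ(A_{γⱼ})` for non-constant rational polynomials `pⱼ` (e.g. the nonzero quadratic forms
  `q_{γⱼ}`), then the `fⱼ` are algebraically independent over `ℚ(B)`, i.e.
  `tr.deg_{ℚ(B)} ℚ(B)(λ(γ₁)², …, λ(γ_m)²) = m` — the display (E:TD-1) with `d = 0`; the last step
  is Lemma 7.2, proved in `PrasadRapinchukLemma72.lean`.

For general `d` the paper extracts `C ⊆ A`, `|C| ≤ d`, with `A ∖ C` algebraically independent over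
`ℚ(B)` and renumbers; that bookkeeping is not repeated here (the Schanuel step above is the only
transcendental input). We work in `ℂ`; the paper's logarithms are real, and `ℝ ⊂ ℂ` changes
neither `ℚ`-linear nor algebraic independence.
-/

noncomputable section

open Complex IntermediateField Set
open Literature.Barriers.Schanuel (AlgIndepLogarithms)

namespace Literature.NumberTheory.Transcendental

namespace PrasadRapinchuk

/-! ### The Schanuel step -/

/-- **The Schanuel step of Prasad–Rapinchuk's Proposition 7.1.** Assume Schanuel's conjecture
(`∀ n, SchanuelRank n`). If `z₁, …, zₙ ∈ ℂ` are `ℚ`-linearly independent and the field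
`ℚ(e^{z₁}, …, e^{zₙ})` has transcendence degree `≤ d`, then `tr.deg_ℚ ℚ(z₁, …, zₙ) ≥ n - d`
(stated additively in cardinals). Proof as printed:
`n ≤ tr.deg ℚ(z, eᶻ) ≤ tr.deg ℚ(z) + tr.deg ℚ(eᶻ)`.
[cite: PrasadRapinchuk2013, proof of Prop. 7.1] -/
theorem le_trdeg_adjoin_add_of_schanuel (hSC : ∀ n, SchanuelRank n) {n : ℕ} (z : Fin n → ℂ)
    (hz : LinearIndependent ℚ z) {d : ℕ}
    (hd : Algebra.trdeg ℚ (adjoin ℚ (Set.range (cexp ∘ z))) ≤ d) :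
    (n : Cardinal) ≤ Algebra.trdeg ℚ (adjoin ℚ (Set.range z)) + d :=
  calc (n : Cardinal) ≤ Algebra.trdeg ℚ (adjoin ℚ (Set.range z ∪ Set.range (cexp ∘ z))) :=
        hSC n z hz
    _ ≤ Algebra.trdeg ℚ (adjoin ℚ (Set.range z)) +
          Algebra.trdeg ℚ (adjoin ℚ (Set.range (cexp ∘ z))) := trdeg_adjoin_union_le _ _
    _ ≤ Algebra.trdeg ℚ (adjoin ℚ (Set.range z)) + d := add_le_add le_rfl hd

/-- "`Ã ∪ B̃ ⊂ 𝒦̄`, so `tr.deg_ℚ ℚ(Ã ∪ B̃) ≤ d`": if every element of `T ⊆ ℂ` is algebraic over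
an intermediate field `K`, then `tr.deg_ℚ ℚ(T) ≤ tr.deg_ℚ K` (`ℚ(T) ⊆ K(T)`, which is algebraic
over `K`). [folklore] -/
theorem trdeg_adjoin_le_of_isAlgebraic (K : IntermediateField ℚ ℂ) {T : Set ℂ}
    (hT : ∀ x ∈ T, IsAlgebraic K x) : Algebra.trdeg ℚ (adjoin ℚ T) ≤ Algebra.trdeg ℚ K := by
  have hmono : Algebra.trdeg ℚ (adjoin ℚ T) ≤ Algebra.trdeg ℚ (adjoin ℚ ((K : Set ℂ) ∪ T)) :=
    trdeg_le_of_injective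
      (IntermediateField.inclusion (adjoin.mono ℚ _ _ Set.subset_union_right))
      (IntermediateField.inclusion_injective _)
  refine hmono.trans ?_
  haveI : Algebra.IsAlgebraic K (adjoin K T) :=
    isAlgebraic_adjoin fun x hx => (hT x hx).isIntegral
  have h := trdeg_add_eq ℚ K (A := adjoin K T)
  rw [trdeg_eq_zero (R := K) (A := adjoin K T), add_zero] at h
  have e := (equivOfEq (restrictScalars_adjoin ℚ K T)).symm.trdeg_eq
  calc Algebra.trdeg ℚ (adjoin ℚ ((K : Set ℂ) ∪ T))
      = Algebra.trdeg ℚ ((adjoin K T).restrictScalars ℚ) := e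
    _ = Algebra.trdeg ℚ (adjoin K T) := rfl
    _ = Algebra.trdeg ℚ K := h.symm
    _ ≤ Algebra.trdeg ℚ K := le_rfl

/-- **The Schanuel step, in the printed form.** Assume Schanuel's conjecture. Let `𝒦 ⊂ ℂ` be a
subfield with `tr.deg_ℚ 𝒦 ≤ d` and let `z₁, …, zₙ` be `ℚ`-linearly independent complex numbers
whose exponentials are algebraic over `𝒦` (in the paper: logarithms of values of characters at
elements of `Γᵢ ⊂ Gᵢ(𝒦)`). Then `tr.deg_ℚ ℚ(z₁, …, zₙ) ≥ n - d`.
[cite: PrasadRapinchuk2013, proof of Prop. 7.1] -/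
theorem le_trdeg_adjoin_add_of_schanuel_of_isAlgebraic (hSC : ∀ n, SchanuelRank n)
    (K : IntermediateField ℚ ℂ) {d : ℕ} (hK : Algebra.trdeg ℚ K ≤ d) {n : ℕ} (z : Fin n → ℂ)
    (hz : LinearIndependent ℚ z) (halg : ∀ i, IsAlgebraic K (cexp (z i))) :
    (n : Cardinal) ≤ Algebra.trdeg ℚ (adjoin ℚ (Set.range z)) + d :=
  le_trdeg_adjoin_add_of_schanuel hSC z hz
    ((trdeg_adjoin_le_of_isAlgebraic K (by rintro _ ⟨i, rfl⟩; exact halg i)).trans hK)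

/-! ### The arithmetic case `d = 0`: Schanuel enters as `AlgIndepLogarithms` -/

/-- For `d = 0` (all `e^{zᵢ}` algebraic, e.g. `Γᵢ` arithmetic) the Schanuel step is exactly the
conjecture `AlgIndepLogarithms` (algebraic independence of `ℚ`-linearly independent logarithms of
algebraic numbers): the concatenated family `A ⊕ B` is algebraically independent over `ℚ`. This is
`AlgIndepLogarithms` transported from `Fin n` to a finite index type.
[cite: PrasadRapinchuk2013, proof of Prop. 7.1] -/
theorem algebraicIndependent_sumElim_of_algIndepLogarithms (h : AlgIndepLogarithms)
    {ι ι' : Type*} [Finite ι] [Finite ι'] {a : ι → ℂ} {b : ι' → ℂ}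
    (ha : ∀ i, IsAlgebraic ℚ (cexp (a i))) (hb : ∀ i, IsAlgebraic ℚ (cexp (b i)))
    (hli : LinearIndependent ℚ (Sum.elim a b)) : AlgebraicIndependent ℚ (Sum.elim a b) := by
  obtain ⟨N, ⟨e⟩⟩ := Finite.exists_equiv_fin (ι ⊕ ι')
  have hli' : LinearIndependent ℚ (Sum.elim a b ∘ e.symm) := hli.comp _ e.symm.injective
  have halg' : ∀ k, IsAlgebraic ℚ (cexp ((Sum.elim a b ∘ e.symm) k)) := by
    intro k
    show IsAlgebraic ℚ (cexp (Sum.elim a b (e.symm k)))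
    cases e.symm k with
    | inl i => exact ha i
    | inr i => exact hb i
  exact (algebraicIndependent_equiv e.symm).1 (h N _ halg' hli')

/-- In the arithmetic case the `A`-block is algebraically independent **over `ℚ(B)`**
(`tr.deg_{ℚ(B)} ℚ(A ∪ B) = |A|`, the case `d = 0` of the paper's count
`tr.deg_{ℚ(B)} ℚ(A ∪ B) ≥ α - d`). [cite: PrasadRapinchuk2013, proof of Prop. 7.1] -/
theorem algebraicIndependent_over_adjoin_of_algIndepLogarithms (h : AlgIndepLogarithms)
    {ι ι' : Type*} [Finite ι] [Finite ι'] {a : ι → ℂ} {b : ι' → ℂ}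
    (ha : ∀ i, IsAlgebraic ℚ (cexp (a i))) (hb : ∀ i, IsAlgebraic ℚ (cexp (b i)))
    (hli : LinearIndependent ℚ (Sum.elim a b)) :
    AlgebraicIndependent (adjoin ℚ (Set.range b)) a :=
  IntermediateField.algebraicIndependent_adjoin_iff.2
    (AlgebraicIndependent.sumElim_iff.1
      (algebraicIndependent_sumElim_of_algIndepLogarithms h ha hb hli)).2

/-- A non-constant polynomial expression (coefficients in the bottom field `F₀`) in a family that
is algebraically independent over the subfield `F` does not lie in `F`: otherwise `map p - C y`
would be a nonzero relation over `F`. (In the paper: `q_γ(a_γ) ∉ ℚ(B)` for the nonzero rational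
quadratic form `q_γ`, the `a_γ` being algebraically independent over `ℚ(B)`.) [folklore] -/
theorem aeval_not_mem_bot_of_algebraicIndependent {F₀ Ω : Type*} [Field F₀] [Field Ω]
    [Algebra F₀ Ω] (F : IntermediateField F₀ Ω) {σ : Type*} {u : σ → Ω}
    (hu : AlgebraicIndependent F u) (p : MvPolynomial σ F₀) (hp : ∀ r, p ≠ MvPolynomial.C r) :
    MvPolynomial.aeval u p ∉ (⊥ : IntermediateField F Ω) := by
  classical
  intro hj
  rw [IntermediateField.mem_bot] at hj
  obtain ⟨y, hy⟩ := hj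
  have hP : MvPolynomial.aeval u (MvPolynomial.map (algebraMap F₀ F) p - MvPolynomial.C y) = 0 := by
    rw [map_sub, MvPolynomial.aeval_map_algebraMap, MvPolynomial.aeval_C, sub_eq_zero]
    exact hy.symm
  have hP0 := (algebraicIndependent_iff.1 hu) _ hP
  rw [sub_eq_zero] at hP0
  apply hp (p.coeff 0)
  ext m
  have hm := congrArg (MvPolynomial.coeff m) hP0
  rw [MvPolynomial.coeff_map, MvPolynomial.coeff_C] at hm
  rw [MvPolynomial.coeff_C]
  split_ifs at hm ⊢ with h0
  · subst h0; rfl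
  · exact (map_eq_zero_iff (algebraMap F₀ F) (algebraMap F₀ F).injective).1 hm

/-- **Transcendence core of Prasad–Rapinchuk's Proposition 7.1, arithmetic case (`d = 0`).**
Assume `AlgIndepLogarithms`. Let `a : ι → ℂ` and `b : ι' → ℂ` be logarithms of algebraic numbers
(`e^{aᵢ}, e^{bᵢ} ∈ ℚ̄`) with `a ⊕ b` `ℚ`-linearly independent (paper: `A ∪ B`, from
"multiplicatively independent" and "not weakly contained"), let the blocks `A_{γⱼ}` be the fibres
of `c : ι → κ`, and let `fⱼ = pⱼ(a|_{c⁻¹{j}})` for rational polynomials `pⱼ` that are not constant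
(paper: `λ_{Γ₁}(γⱼ)² = q_{γⱼ}(a_{γⱼ})` with `q_{γⱼ}` a nonzero rational quadratic form). Then the
`fⱼ` are algebraically independent over `ℚ(B)`:
`tr.deg_{ℚ(B)} ℚ(B)(f₁, …, f_m) = m` — display (E:TD-1) of the paper with `d = 0`
(`ℚ(B) = 𝒫_{Θ₂}`), via `algebraicIndependent_over_adjoin_of_algIndepLogarithms` and Lemma 7.2
(`algebraicIndependent_of_mem_adjoin_fibre`).
[cite: PrasadRapinchuk2013, Prop. 7.1 (proof, case d = 0)] -/
theorem algebraicIndependent_aeval_fibre_of_algIndepLogarithms (h : AlgIndepLogarithms)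
    {ι ι' κ : Type*} [Fintype ι] [Finite ι'] (c : ι → κ) {a : ι → ℂ} {b : ι' → ℂ}
    (ha : ∀ i, IsAlgebraic ℚ (cexp (a i))) (hb : ∀ i, IsAlgebraic ℚ (cexp (b i)))
    (hli : LinearIndependent ℚ (Sum.elim a b))
    (p : (j : κ) → MvPolynomial (c ⁻¹' ({j} : Set κ)) ℚ)
    (hp : ∀ j (r : ℚ), p j ≠ MvPolynomial.C r) :
    AlgebraicIndependent (adjoin ℚ (Set.range b))
      (fun j => MvPolynomial.aeval (fun i : (c ⁻¹' ({j} : Set κ)) => a i) (p j)) := by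
  classical
  set F : IntermediateField ℚ ℂ := adjoin ℚ (Set.range b) with hF
  have haF : AlgebraicIndependent F a :=
    algebraicIndependent_over_adjoin_of_algIndepLogarithms h ha hb hli
  refine algebraicIndependent_of_mem_adjoin_fibre F c haF _ (fun j => ?_) (fun j hj => ?_)
  · -- `f j ∈ ℚ[a-block j] ⊆ F(a-block j)`
    have hle : Algebra.adjoin ℚ (Set.range fun i : (c ⁻¹' ({j} : Set κ)) => a i) ≤
        ((adjoin F (a '' (c ⁻¹' {j}))).restrictScalars ℚ).toSubalgebra := by
      rw [Algebra.adjoin_le_iff]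
      rintro _ ⟨i, rfl⟩
      exact subset_adjoin F _ ⟨i, i.2, rfl⟩
    have hmem : MvPolynomial.aeval (fun i : (c ⁻¹' ({j} : Set κ)) => a i) (p j) ∈
        Algebra.adjoin ℚ (Set.range fun i : (c ⁻¹' ({j} : Set κ)) => a i) := by
      rw [Algebra.adjoin_range_eq_range_aeval]
      exact ⟨p j, rfl⟩
    exact hle hmem
  · -- `f j ∉ F`: the block is algebraically independent over `F` and `p j` is not constant
    exact aeval_not_mem_bot_of_algebraicIndependent F (haF.comp _ Subtype.val_injective) (p j)
      (hp j) hj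


/-! ### Real logarithms (the paper's setting `A ∪ B ⊂ ℝ`) -/

/-- `ℚ`-linear independence of a real family is unchanged by the embedding `ℝ ⊂ ℂ`. [folklore] -/
theorem linearIndependent_ofReal_comp_iff {ι : Type*} {v : ι → ℝ} :
    LinearIndependent ℚ (fun i => (v i : ℂ)) ↔ LinearIndependent ℚ v := by
  let f : ℝ →ₗ[ℚ] ℂ := Complex.ofRealAm.toLinearMap.restrictScalars ℚ
  have hf : LinearMap.ker f = ⊥ :=
    LinearMap.ker_eq_bot.2 fun x y hxy => Complex.ofReal_injective hxy
  exact f.linearIndependent_iff hf (v := v)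

/-- `e^x` (`x` real) is algebraic over `ℚ` as a complex number iff as a real number. [folklore] -/
theorem isAlgebraic_cexp_ofReal_iff {x : ℝ} :
    IsAlgebraic ℚ (cexp x) ↔ IsAlgebraic ℚ (Real.exp x) := by
  rw [← Complex.ofReal_exp]
  exact isAlgebraic_algebraMap_iff (R := ℚ) (A := ℂ) (algebraMap ℝ ℂ).injective

/-- The arithmetic case of Proposition 7.1 with **real** logarithms, as in the paper
(`a_{γ,i} = log χ_i(γ) ∈ ℝ`, `χ_i(γ) > 0` algebraic): same conclusion as
`algebraicIndependent_aeval_fibre_of_algIndepLogarithms` after embedding `ℝ ⊂ ℂ`.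
[cite: PrasadRapinchuk2013, Prop. 7.1 (proof, case d = 0)] -/
theorem algebraicIndependent_aeval_fibre_of_algIndepLogarithms_real (h : AlgIndepLogarithms)
    {ι ι' κ : Type*} [Fintype ι] [Finite ι'] (c : ι → κ) {a : ι → ℝ} {b : ι' → ℝ}
    (ha : ∀ i, IsAlgebraic ℚ (Real.exp (a i))) (hb : ∀ i, IsAlgebraic ℚ (Real.exp (b i)))
    (hli : LinearIndependent ℚ (Sum.elim a b))
    (p : (j : κ) → MvPolynomial (c ⁻¹' ({j} : Set κ)) ℚ)
    (hp : ∀ j (r : ℚ), p j ≠ MvPolynomial.C r) :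
    AlgebraicIndependent (adjoin ℚ (Set.range fun i => (b i : ℂ)))
      (fun j => MvPolynomial.aeval (fun i : (c ⁻¹' ({j} : Set κ)) => (a i : ℂ)) (p j)) := by
  have hli' : LinearIndependent ℚ (Sum.elim (fun i => (a i : ℂ)) (fun i => (b i : ℂ))) := by
    have : Sum.elim (fun i => (a i : ℂ)) (fun i => (b i : ℂ)) =
        fun s => ((Sum.elim a b s : ℝ) : ℂ) := by
      ext (i | i) <;> rfl
    rw [this]
    exact linearIndependent_ofReal_comp_iff.2 hli
  exact algebraicIndependent_aeval_fibre_of_algIndepLogarithms h c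
    (fun i => isAlgebraic_cexp_ofReal_iff.2 (ha i)) (fun i => isAlgebraic_cexp_ofReal_iff.2 (hb i))
    hli' p hp

end PrasadRapinchuk

end Literature.NumberTheory.Transcendental
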